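import Summits.BirchSwinnertonDyer.BirchSwinnertonDyer.Theorems.BiquadraticEisensteinDescentHeegnerTwistCouplingInSupplySymbolicMonskyEvenDesignDoor
import Summits.BirchSwinnertonDyer.BirchSwinnertonDyer.Theorems.BiquadraticEisensteinDescentHeegnerTwistCouplingInSupplySymbolicMonskyEvenDesignMuOne
import HarnessLib

set_option linter.dupNamespace false -- `Summit.BirchSwinnertonDyer.BirchSwinnertonDyer.Theorems.…` (summit = sub)
set_option autoImplicit false

/-!
# Crux `HeegnerTwistCouplingInSupply` (stmt-BirchSwinnertonDyer-21381) — EVEN bases with NO prime `≡ 5 (mod 8)`: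
# at `δ = 1` the `V × 0` section of the even pencil never obstructs (no «vertical» exceptional base in the class family `{1, 3, 7} (mod 8)`)

Route `BiquadraticEisensteinDescent` (cell `pub/bsd-wall`, width seat `bsd-wall-cm-bed-w3` g25; `--supports` 21381, helper). Companion of
`…SymbolicMonskyEvenDesignNoSeven` (w3 g25: the `0 × V` section on bases with no prime `≡ 7 (mod 8)`), `…EvenDesignMuOne` (p756294) and
`…EvenDesignNegTwoOne` (p756989). Setting of `…SymbolicMonskyEvenKernelParity` (p751399): for an even root-number-`−1` base `E_{2·P₀⋯P_k}`
(an odd number of `P_b ≡ 3 (mod 4)`, `hμ`) EVEN THEOREM A (`exists_patternFree_even_design_pencil_of_odd`) needs a `(2/·)`-vector `δ` whose even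
pencil `W_ev(δ)` meets `V × 0` (h1), `0 × V` (h2) and the diagonal (h3) in dimension `≤ τ₀ = (dim 𝒦_ev + 1)/2`. The «vertical» exceptional class
of memo EVEN-EXCEPTIONAL-CLASS-w3g24 (`a₁ > τ₀`: h1 fails for EVERY `δ`; all 2 784 exceptional patterns of the exhaustive `K = 6` census, kit
j337183) always carries primes `≡ 5 (mod 8)`. This file proves that this is forced: on the family of bases WITHOUT a prime `≡ 5 (mod 8)` (every
prime with `(2/P_b) = −1` is `≡ 3 (mod 4)`, i.e. `[(2/P_b) = −1] → [(−1/P_b) = −1]`; classes `1, 3, 7 (mod 8)` arbitrary otherwise) condition (h1)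
holds at `δ = 1` for EVERY base. The family contains `{1,7}` (`…EvenDesignNegTwoTrivial`, δ = 1 universal) and `{1,3}` (`…EvenDesignClassesOneThree`)
and the «horizontal» exceptional bases of the memo (all primes `≡ 3 (mod 4)`), for which (h3) fails — so (h3) is a genuine remaining condition.
* `swap_mem_evenPencil_one_inf_ker_fst_of_noFive` — MECHANISM: if `(w, 0) ∈ W_ev(1)` with `⟨m,w⟩ = 0` then `(0, w) ∈ W_ev(1)`. Indeed
  `(w,0) ∈ W_ev(1)` means `w = v + γ·1` with `(0, v) ∈ 𝒦_ev`; the first kernel equations give `v|_M = 0`, so `⟨m,w⟩ = γμ = γ = 0`, `w = v`,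
  `w|_M = 0`, and — as every prime `≡ ±3 (mod 8)` is `≡ 3 (mod 4)` (`D ⊆ M`) — `w|_D = 0`, whence the second equations give `Lw = 0`; then
  `(w, 0) ∈ 𝒦_ev` and `(0, w) = T_1(w, 0) ∈ W_ev(1)`.
* ★★ `two_mul_finrank_evenPencil_one_inf_ker_snd_le_of_noFive` — hence `2 · dim (W_ev(1) ∩ V×0) ≤ dim 𝒦_ev + 1 = 2τ₀`: the swap embeds the
  codimension-`≤ 1` subspace `{⟨m,w⟩ = 0}` of the `V × 0` section into the `0 × V` section, the two sections are disjoint inside `W_ev(1)`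
  (dimension `dim 𝒦_ev + 1`), so `2·dim (W_ev(1) ∩ V×0) ≤ dim 𝒦_ev + 2`, and the kernel parity `odd_finrank_evenVirtualKernel` removes the last
  unit. So NO base of the family is «vertical»-exceptional, and (h1) of EVEN THEOREM A holds at `δ = 1`.
* ★★★ `exists_patternFree_even_design_one_of_noFive` — two-condition door at `δ = 1` (`0 × V` and diagonal sections `≤ τ₀` ⇒ pattern-free
  Heegner recipe with `τ₀ + 1` auxiliary primes; the `0 × V` condition is conjecture (★), numerically never violated), and ★★★
  `exists_recipe_cruxOn_even_one_of_noFive` — the same through the realisation door `RealisesK.cruxOn_even_of_BT_of_forall` (conclusion of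
  `HeegnerTwistCouplingInSupply` at `(E_{2n}, P₀)` for realising primes in the size window, modulo Burungale–Tian).
HONEST FRAMING: RUNG-LEVEL corner layer (even congruent `j = 1728` families `E_{2n₀}`); `𝔽₂`-linear algebra attached to Monsky matrices
[cite: HeathBrown1994SelmerCongruentII, Appendix (Monsky), typescript p. 41 L20–L36]; instances need located primes (w4 layer) and the print input
[cite: BurungaleTian2026, Thm. 1.1]; the crux as stated (C⁺), its registered stubs and BSD are NOT touched; nothing is closed. THEOREMS ONLY.
-/

namespace Summit.BirchSwinnertonDyer.BirchSwinnertonDyer.Theorems.SymbolicMonsky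

section NoFiveEven

open Module Matrix Literature.NumberTheory.EllipticCurves Literature.NumberTheory.EllipticCurves.HeathBrown1994
  Literature.NumberTheory.EllipticCurves.HeathBrown1994.Families
open Literature.NumberTheory.EllipticCurves.Rank1Residual

variable {k : ℕ} (base : SymbData (k + 1))

/-- An even root-number-`−1` base (`Σ_b [P_b ≡ 3 (4)] = 1` in `𝔽₂`) has some prime `≡ 3 (mod 4)`. -/
private theorem exists_negNegOne_of_sum_eq_one₅ (hμ : (∑ b, bz (negNegOne (base.cls b))) = 1) :
    ∃ b₀, negNegOne (base.cls b₀) = true := by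
  obtain ⟨b₀, -, hb₀⟩ := Finset.exists_ne_zero_of_sum_ne_zero
    (by rw [hμ]; exact one_ne_zero : (∑ b, bz (negNegOne (base.cls b))) ≠ 0)
  refine ⟨b₀, ?_⟩
  cases h : negNegOne (base.cls b₀) with
  | true => rfl
  | false => rw [h] at hb₀; exact absurd (by decide : bz false = 0) hb₀

/-- Cutting a subspace by one linear functional costs at most one dimension. -/
private theorem finrank_le_finrank_inf_ker_add_one₅ {Z : Type*} [AddCommGroup Z] [Module (ZMod 2) Z] [FiniteDimensional (ZMod 2) Z]
    (C : Submodule (ZMod 2) Z) (f : Z →ₗ[ZMod 2] ZMod 2) :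
    finrank (ZMod 2) ↥C ≤ finrank (ZMod 2) ↥(C ⊓ LinearMap.ker f) + 1 := by
  have h1 := Submodule.finrank_sup_add_finrank_inf_eq C (LinearMap.ker f)
  have h2 := LinearMap.finrank_range_add_finrank_ker f
  have h3 : finrank (ZMod 2) ↥(LinearMap.range f) ≤ 1 := by
    have := Submodule.finrank_le (LinearMap.range f)
    rwa [Module.finrank_self] at this
  have h4 : finrank (ZMod 2) ↥(C ⊔ LinearMap.ker f) ≤ finrank (ZMod 2) Z := Submodule.finrank_le _
  omega

/-- Elements of the even pencil at `δ = 1`: `(v + γ·1, u)` for an even kernel pair `(u, v)` and `γ ∈ 𝔽₂`. -/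
private theorem mem_evenPencil_one_iff₅ (p : (Fin (k + 1) → ZMod 2) × (Fin (k + 1) → ZMod 2)) :
    p ∈ base.evenPencil (fun _ => 1) ↔
      ∃ (u v : Fin (k + 1) → ZMod 2) (γ : ZMod 2), (u, v) ∈ base.evenVirtualKernel ∧ p = (fun b => v b + γ, u) := by
  have h11 : (1 : ZMod 2) + 1 = 0 := by decide
  rw [mem_evenPencil_iff]
  constructor
  · rintro ⟨u, v, γ, hE1, hE2, rfl⟩
    refine ⟨u, v, γ, (mem_evenVirtualKernel_iff base (u, v)).2 ⟨hE1, hE2⟩, Prod.ext ?_ ?_⟩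
    · funext b; simp [h11]
    · funext b; simp [h11]
  · rintro ⟨u, v, γ, huv, rfl⟩
    obtain ⟨hE1, hE2⟩ := (mem_evenVirtualKernel_iff base (u, v)).1 huv
    refine ⟨u, v, γ, hE1, hE2, Prod.ext ?_ ?_⟩
    · funext b; simp [h11]
    · funext b; simp [h11]

/-- **MECHANISM (no prime `≡ 5 (mod 8)`).** If `(w, 0)` lies in the even pencil at `δ = 1` and `⟨m,w⟩ = 0`, then `(0, w)` lies in it
too. (`(w,0) ∈ W_ev(1)` means `w = v + γ·1` with `(0, v) ∈ 𝒦_ev`; the first kernel equations give `v|_M = 0`, so `γ = ⟨m,w⟩ = 0`, `w = v`,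
`w|_M = 0`; with `D ⊆ M` also `w|_D = 0`, the second equations give `Lw = 0`, so `(w, 0) ∈ 𝒦_ev` and `(0, w) = T_1(w, 0)`.)
[cite: HeathBrown1994SelmerCongruentII, Appendix (Monsky), typescript p. 41 L20–L36] -/
theorem swap_mem_evenPencil_one_inf_ker_fst_of_noFive
    (h5 : ∀ b, negTwo (base.cls b) = true → negNegOne (base.cls b) = true) (hμ : (∑ b, bz (negNegOne (base.cls b))) = 1)
    (p : (Fin (k + 1) → ZMod 2) × (Fin (k + 1) → ZMod 2))
    (hp : p ∈ base.evenPencil (fun _ => 1) ⊓ LinearMap.ker (LinearMap.snd (ZMod 2) (Fin (k + 1) → ZMod 2) (Fin (k + 1) → ZMod 2)))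
    (hm : (∑ b, bz (negNegOne (base.cls b)) * p.1 b) = 0) :
    ((0, p.1) : (Fin (k + 1) → ZMod 2) × (Fin (k + 1) → ZMod 2)) ∈
      base.evenPencil (fun _ => 1) ⊓ LinearMap.ker (LinearMap.fst (ZMod 2) (Fin (k + 1) → ZMod 2) (Fin (k + 1) → ZMod 2)) := by
  have h2 : ∀ x : ZMod 2, x + x = 0 := by decide
  obtain ⟨hpW, hp0⟩ := Submodule.mem_inf.1 hp
  obtain ⟨u, v, γ, huv, rfl⟩ := (mem_evenPencil_one_iff₅ base p).1 hpW
  rw [LinearMap.mem_ker, LinearMap.snd_apply] at hp0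
  simp only at hp0 hm ⊢
  have hu : ∀ b, u b = 0 := fun b => by rw [hp0]; rfl
  obtain ⟨hE1, hE2⟩ := (mem_evenVirtualKernel_iff base (u, v)).1 huv
  -- the two kernel equations of `(0, v)`
  have e1 : ∀ i, bz (negNegOne (base.cls i)) * v i = 0 := fun i => by
    have e := hE1 i
    simp only [hu, add_zero, mul_zero, Finset.sum_const_zero, zero_add] at e
    exact e
  have e2 : ∀ i, (∑ j, bz (base.neg i j) * (v j + v i)) + bz (negTwo (base.cls i)) * v i = 0 := fun i => by
    have e := hE2 i
    simp only [hu, mul_zero, Finset.sum_const_zero, zero_add, add_zero, e1 i] at e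
    exact e
  -- `γ = ⟨m, v + γ·1⟩ = 0`
  have hγ : γ = 0 := by
    have hs : (∑ b, bz (negNegOne (base.cls b)) * (v b + γ)) = (∑ b, bz (negNegOne (base.cls b))) * γ := by
      rw [Finset.sum_mul]
      exact Finset.sum_congr rfl fun b _ => by linear_combination e1 b
    rw [hs, hμ, one_mul] at hm
    exact hm
  -- no prime `≡ 5 (mod 8)`: `v|_D = 0`, hence `Lv = 0`
  have hdv : ∀ i, bz (negTwo (base.cls i)) * v i = 0 := fun i => by
    cases hi : negTwo (base.cls i) with
    | false => exact zero_mul _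
    | true =>
      have := e1 i
      rw [h5 i hi] at this
      exact this
  have hlap : ∀ i, (∑ j, bz (base.neg i j) * (v j + v i)) = 0 := fun i => by
    have e := e2 i
    rw [hdv i, add_zero] at e
    exact e
  have hmv : (∑ j, bz (negNegOne (base.cls j)) * v j) = 0 := Finset.sum_eq_zero fun j _ => e1 j
  -- `(v, 0) ∈ 𝒦_ev`, so `(0, v) ∈ W_ev(1)`
  have hv0 : (v, (0 : Fin (k + 1) → ZMod 2)) ∈ base.evenVirtualKernel := by
    rw [mem_evenVirtualKernel_iff]
    refine ⟨fun i => ?_, fun i => ?_⟩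
    · simp only [Pi.zero_apply, mul_zero, add_zero, hmv]
      linear_combination hlap i + hdv i
    · simp only [Pi.zero_apply, mul_zero, add_zero, Finset.sum_const_zero, hmv]
      linear_combination hdv i
  have hw : (fun b => v b + γ) = v := funext fun b => by rw [hγ, add_zero]
  rw [hw]
  refine Submodule.mem_inf.2 ⟨?_, by rw [LinearMap.mem_ker, LinearMap.fst_apply]⟩
  rw [mem_evenPencil_one_iff₅]
  exact ⟨v, 0, 0, hv0, Prod.ext (funext fun b => by simp) rfl⟩

/-- ★★ **No «vertical» exceptional base without a prime `≡ 5 (mod 8)`, dimension form**: `2 · dim (W_ev(1) ∩ V×0) ≤ dim 𝒦_ev + 1`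
(`= 2τ₀` by the kernel parity). The swap `(w,0) ↦ (0,w)` embeds the codimension-`≤ 1` part `{⟨m,w⟩ = 0}` of the `V × 0` section into the
`0 × V` section; the two sections are disjoint in `W_ev(1)` (dimension `dim 𝒦_ev + 1`), and `dim 𝒦_ev` is odd.
[cite: HeathBrown1994SelmerCongruentII, Appendix (Monsky), typescript p. 41 L20–L36] -/
theorem two_mul_finrank_evenPencil_one_inf_ker_snd_le_of_noFive
    (h5 : ∀ b, negTwo (base.cls b) = true → negNegOne (base.cls b) = true) (hμ : (∑ b, bz (negNegOne (base.cls b))) = 1) :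
    2 * finrank (ZMod 2) ↥(base.evenPencil (fun _ => 1) ⊓
        LinearMap.ker (LinearMap.snd (ZMod 2) (Fin (k + 1) → ZMod 2) (Fin (k + 1) → ZMod 2))) ≤
      finrank (ZMod 2) ↥base.evenVirtualKernel + 1 := by
  obtain ⟨b₀, hb₀⟩ := exists_negNegOne_of_sum_eq_one₅ base hμ
  set W := base.evenPencil (fun _ => 1) with hWdef
  set C := W ⊓ LinearMap.ker (LinearMap.fst (ZMod 2) (Fin (k + 1) → ZMod 2) (Fin (k + 1) → ZMod 2)) with hC
  set A := W ⊓ LinearMap.ker (LinearMap.snd (ZMod 2) (Fin (k + 1) → ZMod 2) (Fin (k + 1) → ZMod 2)) with hA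
  -- the linear condition `⟨m, p.1⟩ = 0`
  obtain ⟨φm, hφm⟩ := exists_dot_dual (k := k) (fun b => bz (negNegOne (base.cls b)))
  set fm := φm.comp (LinearMap.fst (ZMod 2) (Fin (k + 1) → ZMod 2) (Fin (k + 1) → ZMod 2)) with hfm
  set A₀ := A ⊓ LinearMap.ker fm with hA₀
  -- the swap
  set e := LinearEquiv.prodComm (ZMod 2) (Fin (k + 1) → ZMod 2) (Fin (k + 1) → ZMod 2) with he
  have hA₀C : A₀.map e.toLinearMap ≤ C := by
    intro q hq
    obtain ⟨p, hp, rfl⟩ := Submodule.mem_map.1 hq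
    obtain ⟨hpA, hpm⟩ := Submodule.mem_inf.1 hp
    have hp0 : p.2 = 0 := by
      have := (Submodule.mem_inf.1 hpA).2
      rwa [LinearMap.mem_ker, LinearMap.snd_apply] at this
    have hm : (∑ b, bz (negNegOne (base.cls b)) * p.1 b) = 0 := by
      rw [LinearMap.mem_ker, hfm, LinearMap.comp_apply, LinearMap.fst_apply, hφm] at hpm
      exact hpm
    have hsw : e.toLinearMap p = (0, p.1) := by
      rw [LinearEquiv.coe_toLinearMap, he, LinearEquiv.prodComm_apply, Prod.swap, hp0]
    rw [hsw]
    exact swap_mem_evenPencil_one_inf_ker_fst_of_noFive base h5 hμ p hpA hm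
  -- dimension count
  have hle₁ : finrank (ZMod 2) ↥(A₀.map e.toLinearMap) ≤ finrank (ZMod 2) ↥C := Submodule.finrank_mono hA₀C
  rw [← LinearEquiv.finrank_eq (Submodule.equivMapOfInjective _ e.injective A₀)] at hle₁
  have hcod₁ : finrank (ZMod 2) ↥A ≤ finrank (ZMod 2) ↥A₀ + 1 := finrank_le_finrank_inf_ker_add_one₅ A fm
  have hCA : C ⊓ A = ⊥ := by
    rw [Submodule.eq_bot_iff]
    intro p hp
    obtain ⟨hpC, hpA⟩ := Submodule.mem_inf.1 hp
    have h1 : p.1 = 0 := by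
      have := (Submodule.mem_inf.1 hpC).2
      rwa [LinearMap.mem_ker, LinearMap.fst_apply] at this
    have hp2 : p.2 = 0 := by
      have := (Submodule.mem_inf.1 hpA).2
      rwa [LinearMap.mem_ker, LinearMap.snd_apply] at this
    exact Prod.ext h1 hp2
  have hsup : C ⊔ A ≤ W := sup_le inf_le_left inf_le_left
  have hW : finrank (ZMod 2) ↥W = finrank (ZMod 2) ↥base.evenVirtualKernel + 1 :=
    finrank_evenPencil_eq base (fun _ => 1) (evenPencil_one_legit base b₀ hb₀)
  have hsum := Submodule.finrank_sup_add_finrank_inf_eq C A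
  rw [hCA, finrank_bot, add_zero] at hsum
  have hmono := Submodule.finrank_mono hsup
  obtain ⟨r, hr⟩ := odd_finrank_evenVirtualKernel base hμ
  omega

/-- ★★★ **EVEN DOOR AT δ = 1 for bases with no prime `≡ 5 (mod 8)` (two conditions).** For an even root-number-`−1` base `E_{2·P₀⋯P_k}`
all of whose primes `≡ ±3 (mod 8)` are `≡ 3 (mod 8)`, put `τ₀ := (dim 𝒦_ev + 1)/2`. If the even pencil at `δ = 1` meets `0 × V` and the
diagonal in dimension `≤ τ₀`, a pattern-free Heegner recipe with `τ₀ + 1` auxiliary primes exists (cells `c₁ :: rest`, `|rest| = τ₀`, `heegnerK`,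
Monsky's even matrix invertible for EVERY mutual pattern). [cite: HeathBrown1994SelmerCongruentII, Appendix (Monsky), typescript p. 41 L20–L36] -/
theorem exists_patternFree_even_design_one_of_noFive
    (h5 : ∀ b, negTwo (base.cls b) = true → negNegOne (base.cls b) = true) (hμ : (∑ b, bz (negNegOne (base.cls b))) = 1)
    (h2 : finrank (ZMod 2) ↥(base.evenPencil (fun _ => 1) ⊓
      LinearMap.ker (LinearMap.fst (ZMod 2) (Fin (k + 1) → ZMod 2) (Fin (k + 1) → ZMod 2))) ≤
        (finrank (ZMod 2) ↥base.evenVirtualKernel + 1) / 2)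
    (h3 : finrank (ZMod 2) ↥(base.evenPencil (fun _ => 1) ⊓
      LinearMap.ker (LinearMap.fst (ZMod 2) (Fin (k + 1) → ZMod 2) (Fin (k + 1) → ZMod 2) +
        LinearMap.snd (ZMod 2) (Fin (k + 1) → ZMod 2) (Fin (k + 1) → ZMod 2))) ≤
        (finrank (ZMod 2) ↥base.evenVirtualKernel + 1) / 2) :
    ∃ (c₁ : AuxCell) (rest : List AuxCell), rest.length = (finrank (ZMod 2) ↥base.evenVirtualKernel + 1) / 2 ∧
      heegnerK base (c₁ :: rest) = true ∧ ∀ pat : ℕ → ℕ → Bool, (dataK base (c₁ :: rest) pat).monskyEvenS.det = 1 := by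
  obtain ⟨b₀, hb₀⟩ := exists_negNegOne_of_sum_eq_one₅ base hμ
  obtain ⟨r, hr⟩ := odd_finrank_evenVirtualKernel base hμ
  have h1 : finrank (ZMod 2) ↥(base.evenPencil (fun _ => 1) ⊓
      LinearMap.ker (LinearMap.snd (ZMod 2) (Fin (k + 1) → ZMod 2) (Fin (k + 1) → ZMod 2))) ≤
        (finrank (ZMod 2) ↥base.evenVirtualKernel + 1) / 2 := by
    have := two_mul_finrank_evenPencil_one_inf_ker_snd_le_of_noFive base h5 hμ
    omega
  exact exists_patternFree_even_design_pencil_of_odd base hμ (fun _ => 1) (evenPencil_one_legit base b₀ hb₀) h1 h2 h3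

/-- ★★★ **The same through the realisation door**: for every even root-number-`−1` base with no prime `≡ 5 (mod 8)` whose even pencil at
`δ = 1` meets `0 × V` and the diagonal in dimension `≤ τ₀^{ev}`, one cell list `aux` (`τ₀^{ev} + 1` cells, `heegnerK`) such that any realising
primes in the size window give the conclusion of `HeegnerTwistCouplingInSupply` at `(E_{2n}, P₀)`, modulo Burungale–Tian.
[cite: HeathBrown1994SelmerCongruentII, Appendix (Monsky), typescript p. 41 L20–L36] [cite: BurungaleTian2026, Thm. 1.1]
[cite: Oesterle1988Gauss, II §3 Proposition p. 57 (27)] -/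
theorem exists_recipe_cruxOn_even_one_of_noFive (hBT : burungaleTian_analyticRank_eq_zero_of_selmerCorank_eq_zero_of_hasCM)
    (h5 : ∀ b, negTwo (base.cls b) = true → negNegOne (base.cls b) = true) (hμ : (∑ b, bz (negNegOne (base.cls b))) = 1)
    (h2 : finrank (ZMod 2) ↥(base.evenPencil (fun _ => 1) ⊓
      LinearMap.ker (LinearMap.fst (ZMod 2) (Fin (k + 1) → ZMod 2) (Fin (k + 1) → ZMod 2))) ≤
        (finrank (ZMod 2) ↥base.evenVirtualKernel + 1) / 2)
    (h3 : finrank (ZMod 2) ↥(base.evenPencil (fun _ => 1) ⊓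
      LinearMap.ker (LinearMap.fst (ZMod 2) (Fin (k + 1) → ZMod 2) (Fin (k + 1) → ZMod 2) +
        LinearMap.snd (ZMod 2) (Fin (k + 1) → ZMod 2) (Fin (k + 1) → ZMod 2))) ≤
        (finrank (ZMod 2) ↥base.evenVirtualKernel + 1) / 2) :
    ∃ aux : List AuxCell, aux.length = (finrank (ZMod 2) ↥base.evenVirtualKernel + 1) / 2 + 1 ∧ heegnerK base aux = true ∧
      ∀ (P : Fin (k + 1) → ℕ) (q : Fin aux.length → ℕ), RealisesK base aux P q →
        ∀ (n : ℕ) [(congruentNumberCurve (2 * n)).IsElliptic], (∏ b, P b) = n →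
          Real.sqrt ((∏ j, q j : ℕ) : ℝ) * Real.log ((∏ j, q j : ℕ) : ℝ) < Real.pi * P 0 →
          ∃ (K : Type) (_ : Field K) (_ : NumberField K),
            IsImaginaryQuadratic K ∧ 4 < (NumberField.discr K).natAbs ∧
            SatisfiesHeegnerHypothesis ((congruentNumberCurve (2 * n)).conductorNorm ℤ) K ∧
            ((congruentNumberCurve (2 * n)).quadraticTwist (NumberField.discr K : ℚ)).entireLFunction 1 ≠ 0 ∧
            ¬ P 0 ∣ NumberField.classNumber K := by
  obtain ⟨c₁, rest, hlen, hH, hdet⟩ := exists_patternFree_even_design_one_of_noFive base h5 hμ h2 h3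
  refine ⟨c₁ :: rest, by simp [hlen], hH, ?_⟩
  intro P q hR n _ hn hsize
  exact hR.cruxOn_even_of_BT_of_forall hBT hH hdet hn hsize

end NoFiveEven

end Summit.BirchSwinnertonDyer.BirchSwinnertonDyer.Theorems.SymbolicMonsky
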